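import Summits.CriticalPhenomena.Ising3DConformalLimit.Theses.PrecisionLaplacian
import Literature.Probability.LatticeModels.GKSInequalities
import Literature.Barriers.CriticalPhenomena.ScaleCovarianceNotMoebius

/-!
# Sketch — crux-ideate round 2, ideator k = 4, crux stmt-CriticalPhenomena-4801 `MoebiusLimitOfTwoPointLaw`

Card `amputated-lebowitz-vertex-measure`: the first lemmas of the line, typed over existing declarations.

* `AmputatedLebowitz` — the NEW lattice inequality (conjecture VP¹, exact-enumeration evidence, ≈ 200 finite
  ferromagnets, 0 violations; exact on trees): for every finite zero-field pair ferromagnet the connected four-point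
  function stays Lebowitz-signed after ONE amputation by the precision matrix `Σ⁻¹`:
  `∑ₐ (Σ⁻¹)_{z a} U₄(a, x₂, x₃, x₄) ≤ 0`. Equivalently `−U₄(·; x₂,x₃,x₄) = Σ ν` with a POSITIVE vertex charge `ν`.
* `HasVertexMeasure Δ c S` — its continuum shadow for a family `S` with two-point function `c‖x−y‖^{-2Δ}`:
  `−U₄(x₁; x₂,x₃,x₄) = ∫ c‖x₁ − z‖^{-2Δ} dν(z)` off the other three points, `ν` a finite (positive) measure.
* `VertexMeasureOfLimit` — the transfer statement the line must prove: under item 0634 (the crux hypothesis),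
  `AmputatedLebowitz` passes to every pointwise scaling limit of `criticalCorr 3` in the canonical renormalisation.
* `OneSidedVertexDomination` — what inversion covariance of `U₄` becomes in vertex-measure form.
-/

noncomputable section

namespace Summit.CriticalPhenomena.Ising3DConformalLimit.Cruxes.MoebiusLimitOfTwoPointLaw.IdeatorK4R2

open Literature.Probability.LatticeModels Filter Topology MeasureTheory

/-! ## Lattice side: finite zero-field pair ferromagnets in the `gksExpect` vocabulary (as in `InverseMFerromagnet`) -/

/-- Pair correlation `⟨σ_p σ_q⟩` of the finite ferromagnet `(K, C)` (all couplings switched on). -/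
def pairCorr (n m : ℕ) (K : Fin m → ℝ) (C : Fin m → Finset (Fin n)) (p q : Fin n) : ℝ :=
  gksExpect Finset.univ K C (fun ω => spinAt p ω * spinAt q ω)

/-- Four-spin correlation `⟨σ_a σ_b σ_c σ_e⟩` (sites may coincide; `σ² = 1`). -/
def fourCorr (n m : ℕ) (K : Fin m → ℝ) (C : Fin m → Finset (Fin n)) (a b c e : Fin n) : ℝ :=
  gksExpect Finset.univ K C (fun ω => spinAt a ω * spinAt b ω * spinAt c ω * spinAt e ω)

/-- Connected (Ursell) four-point function `U₄(a,b,c,e)` of the finite ferromagnet (zero field: odd moments vanish). -/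
def ursellFour (n m : ℕ) (K : Fin m → ℝ) (C : Fin m → Finset (Fin n)) (a b c e : Fin n) : ℝ :=
  fourCorr n m K C a b c e -
    (pairCorr n m K C a b * pairCorr n m K C c e + pairCorr n m K C a c * pairCorr n m K C b e +
      pairCorr n m K C a e * pairCorr n m K C b c)

/-- The precision matrix `Σ⁻¹` of the spin second moments (`Σ` is positive definite, so `Matrix.inv` is the inverse). -/
def precision (n m : ℕ) (K : Fin m → ℝ) (C : Fin m → Finset (Fin n)) : Matrix (Fin n) (Fin n) ℝ :=
  (Matrix.of fun (p q : Fin n) => pairCorr n m K C p q)⁻¹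

/-- The VERTEX CHARGE of `(x₂,x₃,x₄)` at the site `z`: one-leg amputation of `−U₄` by the precision matrix,
`ν(z) = ∑ₐ (Σ⁻¹)_{z a} (−U₄(a, x₂, x₃, x₄))`. -/
def vertexCharge (n m : ℕ) (K : Fin m → ℝ) (C : Fin m → Finset (Fin n)) (z x₂ x₃ x₄ : Fin n) : ℝ :=
  ∑ a : Fin n, precision n m K C z a * (-(ursellFour n m K C a x₂ x₃ x₄))

/-- **Conjecture VP¹ (amputated Lebowitz).** For every finite ZERO-FIELD PAIR ferromagnet (couplings `K_i ≥ 0` on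
pairs `C_i`, `|C_i| = 2`), every site `z` and every triple `x₂,x₃,x₄`, the vertex charge is nonnegative:
`∑ₐ (Σ⁻¹)_{z a} U₄(a,x₂,x₃,x₄) ≤ 0`. Lebowitz (`U₄ ≤ 0`) is the special case of test vectors `h = δ_a`;
VP¹ is Lebowitz for every SIGNED test vector `h` with `Σ h ≥ 0`. Exact on trees (point charge at the median of
`x₂,x₃,x₄`); two amputations fail (VP² is false already on the 6-cycle). -/
def AmputatedLebowitz : Prop :=
  ∀ (n m : ℕ) (K : Fin m → ℝ) (C : Fin m → Finset (Fin n)), (∀ i, 0 ≤ K i) → (∀ i, (C i).card = 2) →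
    ∀ z x₂ x₃ x₄ : Fin n, 0 ≤ vertexCharge n m K C z x₂ x₃ x₄

/-- The companion upper bound observed in every tested case: `ν(z) ≤ 2⟨σ_z σ_{x₂} σ_{x₃} σ_{x₄}⟩`
(on trees: equality at the median, `0` elsewhere) — the shape of a law `2·⟨σ_z σ_X⟩·P[z is the branch vertex]`. -/
def VertexChargeLeFour : Prop :=
  ∀ (n m : ℕ) (K : Fin m → ℝ) (C : Fin m → Finset (Fin n)), (∀ i, 0 ≤ K i) → (∀ i, (C i).card = 2) →
    ∀ z x₂ x₃ x₄ : Fin n, vertexCharge n m K C z x₂ x₃ x₄ ≤ 2 * fourCorr n m K C z x₂ x₃ x₄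

/-! ## Continuum side -/

/-- Points of `ℝ³`. -/
abbrev E3 : Type := EuclideanSpace ℝ (Fin 3)

/-- **Vertex-measure representation** of the connected four-point function of a continuum family `S` whose two-point
function is `c‖x−y‖^{-2Δ}`: for every triple there is a finite positive measure `ν` on `ℝ³` with
`−U₄(x₁; x₂,x₃,x₄) = ∫ c‖x₁ − z‖^{-2Δ} dν(z)` at every non-coincident configuration (the kernel being
`ν`-integrable there: no Bochner junk) — i.e. `−U₄` is the Riesz
potential (exponent `2Δ`) of a positive charge in EACH variable, hence `(−Δ)^{3/2−Δ}`-superharmonic. -/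
def HasVertexMeasure (Δ c : ℝ) (S : CorrFamily 3) : Prop :=
  ∀ x₂ x₃ x₄ : E3, ∃ ν : Measure E3, IsFiniteMeasure ν ∧
    ∀ x₁ : E3, (![x₁, x₂, x₃, x₄] : Fin 4 → E3) ∈ NonCoincident 3 4 →
      Integrable (fun z => c * ‖x₁ - z‖ ^ (-(2 * Δ))) ν ∧
        limitConnectedFour S ![x₁, x₂, x₃, x₄] = -∫ z, c * ‖x₁ - z‖ ^ (-(2 * Δ)) ∂ν

/-- **First lemma of the line (transfer).** Under the crux hypothesis (item 0634: `⟨σ₀σ_x⟩_{β_c}‖x‖₂^{2Δ} → c > 0`),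
the lattice inequality VP¹ passes to every pointwise scaling limit of `criticalCorr 3` in the canonical
renormalisation `ρ = δ^{-Δ}` (Disproof `crux_iff_canonical`): the rescaled vertex charges are positive measures of
bounded mass (Lebowitz/GKS), the rescaled kernels `δ^{-2Δ}⟨σ_{[x/δ]}σ_{[z/δ]}⟩` converge to `c‖x−z‖^{-2Δ}` locally
uniformly off the diagonal (this IS the two-point law: `Negative.TwoPointConvergence`), the infrared bound dominates,
and weak limits of positive measures are positive. -/
def VertexMeasureOfLimit : Prop :=
  AmputatedLebowitz →
    ∀ (Δ c : ℝ), 0 < c →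
      Tendsto (fun x : Site 3 =>
        criticalTwoPoint 3 x * Real.sqrt (∑ i, ((x i : ℝ)) ^ 2) ^ (2 * Δ)) cofinite (nhds c) →
      ∀ S : CorrFamily 3, HasPointwiseScalingLimit (criticalCorr 3) (fun δ => δ ^ (-Δ)) S →
        HasVertexMeasure Δ c S

/-- **What inversion covariance of `U₄` becomes.** With `−U₄(·;X) = c I_{2Δ} ν_X`, the Kelvin transform maps Riesz
potentials of positive measures to Riesz potentials of positive measures, so unit-inversion covariance of `U₄` with
weight `Δ` is the statement that for every triple `X` avoiding `0` the measure of the inverted triple is the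
reweighted push-forward of `ν_X`: `ν_{ιX} = (∏_{j} ‖x_j‖^{2Δ}) · ι_* (‖z‖^{-2Δ} ν_X)` — covariance of ONE positive
measure-valued function of a triangle, weight `Δ` at the corners and the SHADOW weight `3 − Δ` at the vertex point.
By dilation-homogeneity and `ι`-oddness of the inversion defect (sibling line `inversion-defect-involution`,
kernel-checked there), a ONE-SIDED domination on triples inside the unit ball already is the identity. -/
def OneSidedVertexDomination (Δ : ℝ) (ν : (Fin 3 → E3) → Measure E3) : Prop :=
  ∀ X : Fin 3 → E3, (∀ j, X j ≠ 0) → (∀ j, ‖X j‖ ≤ 1) →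
    ν (fun j => EuclideanGeometry.inversion 0 1 (X j)) ≤
      ENNReal.ofReal (∏ j, ‖X j‖ ^ (2 * Δ)) • (Measure.map (EuclideanGeometry.inversion (0 : E3) 1)
        ((ν X).withDensity fun z => ENNReal.ofReal (‖z‖ ^ (-(2 * Δ)))))


/-! ## Teeth against the catalogued barrier witness -/

/-- **Monopole lower bound for positive Riesz potentials** (provable now, M): if `p(x) = ∫ c‖x − z‖^{-2Δ} dν(z)` with `ν ≠ 0`
finite positive, `0 < c`, `0 < Δ`, then `‖x‖^{2Δ} p(x)` does NOT tend to `0` at infinity (Fatou on `B_R`: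
`liminf ‖x‖^{2Δ} p(x) ≥ c ν(B_R)` for every `R`). Hence a connected four-point function that decays faster than the two-point
function in one variable has NO vertex measure unless it vanishes. -/
def PositivePotentialMonopoleLowerBound : Prop :=
  ∀ (Δ c : ℝ), 0 < Δ → 0 < c → ∀ (ν : Measure E3), IsFiniteMeasure ν → ν ≠ 0 →
    ¬ Tendsto (fun x : E3 => ‖x‖ ^ (2 * Δ) * ∫ z, c * ‖x - z‖ ^ (-(2 * Δ)) ∂ν) (cocompact E3) (nhds 0)

/-- **The barrier witness has no vertex measure** (provable now from the previous lemma, M): for the sharpened witness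
`ScaleNotMoebius.narrowFamily Δ` of `Literature.Barriers.CriticalPhenomena.ScaleCovarianceNotMoebiusNarrow` one has
`U₄ = −bump`, `bump Δ x = (∑ᵢⱼ ‖xᵢ − xⱼ‖²)^{-2Δ}` (`limitConnectedFour_narrowFamily`), which in the variable `x₁` decays like
`‖x₁‖^{-4Δ}`, faster than any non-zero positive `I_{2Δ}`-potential, and is not identically zero. So the continuum form of VP¹
EXCLUDES the catalogued non-Möbius witness from the cluster set — the inequality is outside the barrier's technique class
(1)–(13), all of which `narrowFamily` satisfies. -/
def NarrowFamilyHasNoVertexMeasure : Prop :=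
  ∀ Δ : ℝ, 0 < Δ → ¬ HasVertexMeasure Δ 1 (Literature.Barriers.CriticalPhenomena.ScaleNotMoebius.narrowFamily Δ)


/-! ## Proof of the barrier evasion (kernel-checked) -/

section BarrierEvasionProof

open Literature.Barriers.CriticalPhenomena.ScaleNotMoebius Metric

/-- The unit vector `e₀`. -/
private def e0 : E3 := EuclideanSpace.single (0 : Fin 3) (1 : ℝ)

private theorem norm_e0 : ‖e0‖ = 1 := by
  rw [e0, EuclideanSpace.norm_single, norm_one]  -- (deprecated alias ok)

private theorem e0_ne_zero : e0 ≠ 0 := by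
  rw [← norm_ne_zero_iff, norm_e0]; exact one_ne_zero

/-- The test configuration `(t e₀, e₀, 2e₀, 3e₀)`. -/
private def cfg (t : ℝ) : Fin 4 → E3 := ![t • e0, e0, (2 : ℝ) • e0, (3 : ℝ) • e0]

/-- Its scalar pattern. -/
private def scal (t : ℝ) : Fin 4 → ℝ := ![t, 1, 2, 3]

private theorem cfg_eq_scal_smul (t : ℝ) (i : Fin 4) : cfg t i = scal t i • e0 := by
  fin_cases i <;> simp [cfg, scal]

private theorem scal_injective {t : ℝ} (ht : 3 < t) : Function.Injective (scal t) := by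
  intro i j h
  fin_cases i <;> fin_cases j <;> simp [scal] at h ⊢ <;> linarith

private theorem cfg_injective {t : ℝ} (ht : 3 < t) : Function.Injective (cfg t) := by
  intro i j h
  rw [cfg_eq_scal_smul, cfg_eq_scal_smul] at h
  exact scal_injective ht (smul_left_injective ℝ e0_ne_zero h)

private theorem norm_t_smul_e0 {t : ℝ} (ht : 0 < t) : ‖t • e0‖ = t := by
  rw [norm_smul, norm_e0, mul_one, Real.norm_eq_abs, abs_of_pos ht]

/-- `bump ≤ (t-1)^{-4Δ}` along the test configuration (one pair bound `bump ≤ twoPt²`). -/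
private theorem bump_cfg_le {Δ t : ℝ} (hΔ : 0 < Δ) (ht : 3 < t) :
    bump Δ (cfg t) ≤ ((t - 1) ^ (-(2 * Δ))) ^ 2 := by
  have h01 : cfg t 0 ≠ cfg t 1 := fun h => by
    have := cfg_injective ht h; exact absurd this (by decide)
  have h := bump_le_twoPt_sq hΔ.le h01
  have hdiff : cfg t 0 - cfg t 1 = (t - 1) • e0 := by
    simp only [cfg, Matrix.cons_val_zero, Matrix.cons_val_one]
    rw [sub_smul, one_smul]
  have hnorm : ‖cfg t 0 - cfg t 1‖ = t - 1 := by
    rw [hdiff, norm_t_smul_e0 (by linarith)]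
  rw [twoPt, hnorm] at h
  exact h

/-- **The barrier witness has no vertex measure** — kernel-checked. -/
theorem narrowFamilyHasNoVertexMeasure : NarrowFamilyHasNoVertexMeasure := by
  intro Δ hΔ hV
  obtain ⟨ν, hfin, hrep⟩ := hV e0 ((2 : ℝ) • e0) ((3 : ℝ) • e0)
  -- the representation read along the test configuration
  have hbump : ∀ t : ℝ, 3 < t →
      Integrable (fun z => ‖t • e0 - z‖ ^ (-(2 * Δ))) ν ∧
        bump Δ (cfg t) = ∫ z, ‖t • e0 - z‖ ^ (-(2 * Δ)) ∂ν := by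
    intro t ht
    have hx : (![t • e0, e0, (2 : ℝ) • e0, (3 : ℝ) • e0] : Fin 4 → E3) ∈ NonCoincident 3 4 :=
      (mem_nonCoincident _).2 (cfg_injective ht)
    obtain ⟨hint, hEq⟩ := hrep (t • e0) hx
    have hcfg : (![t • e0, e0, (2 : ℝ) • e0, (3 : ℝ) • e0] : Fin 4 → E3) = cfg t := rfl
    rw [hcfg, limitConnectedFour_narrowFamily Δ (cfg_injective ht)] at hEq
    simp only [one_mul] at hint hEq
    exact ⟨hint, by linarith⟩
  by_cases hν : ν = 0
  · obtain ⟨-, hb⟩ := hbump 4 (by norm_num)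
    rw [hν, integral_zero_measure] at hb
    exact absurd hb (bump_pos Δ (cfg_injective (by norm_num : (3:ℝ) < 4))).ne'
  · -- a ball of positive mass
    have huniv : ν Set.univ ≠ 0 := by rwa [Ne, Measure.measure_univ_eq_zero]
    obtain ⟨R, hR⟩ : ∃ R : ℕ, 0 < ν (closedBall (0 : E3) R) := by
      by_contra hcon
      push Not at hcon
      have h0 : ∀ n : ℕ, ν (closedBall (0 : E3) n) = 0 := fun n => nonpos_iff_eq_zero.1 (hcon n)
      have hU : (Set.univ : Set E3) = ⋃ n : ℕ, closedBall (0 : E3) n := by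
        ext z
        simp only [Set.mem_univ, Set.mem_iUnion, mem_closedBall, dist_zero_right, true_iff]
        exact exists_nat_ge ‖z‖
      exact huniv (by rw [hU]; exact measure_iUnion_null h0)
    set m : ℝ := (ν (closedBall (0 : E3) R)).toReal with hm
    have hmpos : 0 < m := ENNReal.toReal_pos hR.ne' (measure_ne_top ν _)
    have hRnn : (0 : ℝ) ≤ R := Nat.cast_nonneg R
    -- lower bound along the test configuration, for t ≥ R + 1
    have hlow : ∀ t : ℝ, (R : ℝ) + 1 ≤ t → 3 < t → m * (t + R) ^ (-(2 * Δ)) ≤ bump Δ (cfg t) := by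
      intro t hRt ht
      obtain ⟨hint, hb⟩ := hbump t ht
      have htpos : 0 < t := by linarith
      have hball : ∀ z ∈ closedBall (0 : E3) R, (t + R) ^ (-(2 * Δ)) ≤ ‖t • e0 - z‖ ^ (-(2 * Δ)) := by
        intro z hz
        rw [mem_closedBall, dist_zero_right] at hz
        have hte : ‖t • e0‖ = t := norm_t_smul_e0 htpos
        have hpos : 0 < ‖t • e0 - z‖ := by
          have h1 := norm_sub_norm_le (t • e0) z
          rw [hte] at h1
          linarith
        have hle : ‖t • e0 - z‖ ≤ t + R := by
          calc ‖t • e0 - z‖ ≤ ‖t • e0‖ + ‖z‖ := norm_sub_le _ _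
            _ ≤ t + R := by rw [hte]; linarith
        exact Real.rpow_le_rpow_of_nonpos hpos hle (by linarith)
      have hconst : IntegrableOn (fun _ : E3 => (t + R) ^ (-(2 * Δ))) (closedBall (0 : E3) R) ν :=
        integrableOn_const
      have hstep1 : m * (t + R) ^ (-(2 * Δ)) = ∫ _ in closedBall (0 : E3) R, (t + R) ^ (-(2 * Δ)) ∂ν := by
        rw [setIntegral_const, smul_eq_mul, hm, measureReal_def]
      rw [hb, hstep1]
      calc ∫ _ in closedBall (0 : E3) R, (t + R) ^ (-(2 * Δ)) ∂ν
          ≤ ∫ z in closedBall (0 : E3) R, ‖t • e0 - z‖ ^ (-(2 * Δ)) ∂ν :=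
            setIntegral_mono_on hconst hint.integrableOn measurableSet_closedBall hball
        _ ≤ ∫ z, ‖t • e0 - z‖ ^ (-(2 * Δ)) ∂ν :=
            setIntegral_le_integral hint (Eventually.of_forall fun z => Real.rpow_nonneg (norm_nonneg _) _)
    -- crude comparisons for t ≥ 2R + 4
    have key : ∀ t : ℝ, 2 * (R : ℝ) + 4 ≤ t → m * (2 : ℝ) ^ (-(2 * Δ)) ≤ (2 : ℝ) ^ (4 * Δ) * t ^ (-(2 * Δ)) := by
      intro t hRt
      have ht3 : (3 : ℝ) < t := by linarith
      have htpos : 0 < t := by linarith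
      have h1 := hlow t (by linarith) ht3
      have h2 := bump_cfg_le hΔ ht3
      -- (t+R)^{-2Δ} ≥ (2t)^{-2Δ} = 2^{-2Δ} t^{-2Δ}
      have hA : (2 * t) ^ (-(2 * Δ)) ≤ (t + R) ^ (-(2 * Δ)) :=
        Real.rpow_le_rpow_of_nonpos (by linarith) (by linarith) (by linarith)
      have hA' : (2 * t) ^ (-(2 * Δ)) = (2 : ℝ) ^ (-(2 * Δ)) * t ^ (-(2 * Δ)) :=
        Real.mul_rpow (by norm_num) htpos.le
      -- (t-1)^{-2Δ} ≤ (t/2)^{-2Δ} = 2^{2Δ} t^{-2Δ}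
      have hB : (t - 1) ^ (-(2 * Δ)) ≤ (t / 2) ^ (-(2 * Δ)) :=
        Real.rpow_le_rpow_of_nonpos (by linarith) (by linarith) (by linarith)
      have hB' : (t / 2) ^ (-(2 * Δ)) = (2 : ℝ) ^ (2 * Δ) * t ^ (-(2 * Δ)) := by
        rw [Real.div_rpow htpos.le (by norm_num), Real.rpow_neg (by norm_num : (0:ℝ) ≤ 2), div_inv_eq_mul,
          mul_comm]
      have hBnn : 0 ≤ (t - 1) ^ (-(2 * Δ)) := Real.rpow_nonneg (by linarith) _
      have hB2 : ((t - 1) ^ (-(2 * Δ))) ^ 2 ≤ ((2 : ℝ) ^ (2 * Δ) * t ^ (-(2 * Δ))) ^ 2 := by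
        rw [← hB']; exact pow_le_pow_left₀ hBnn hB 2
      have hsq : ((2 : ℝ) ^ (2 * Δ) * t ^ (-(2 * Δ))) ^ 2 = (2 : ℝ) ^ (4 * Δ) * (t ^ (-(2 * Δ)) * t ^ (-(2 * Δ))) := by
        have : ((2 : ℝ) ^ (2 * Δ)) ^ 2 = (2 : ℝ) ^ (4 * Δ) := by
          rw [← Real.rpow_natCast, ← Real.rpow_mul (by norm_num : (0:ℝ) ≤ 2)]; norm_num; ring_nf
        rw [mul_pow, this, pow_two]
      -- chain: m 2^{-2Δ} t^{-2Δ} ≤ m (t+R)^{-2Δ} ≤ bump ≤ ((t-1)^{-2Δ})² ≤ 2^{4Δ} t^{-2Δ} t^{-2Δ}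
      have hchain : m * ((2 : ℝ) ^ (-(2 * Δ)) * t ^ (-(2 * Δ))) ≤ (2 : ℝ) ^ (4 * Δ) * (t ^ (-(2 * Δ)) * t ^ (-(2 * Δ))) := by
        calc m * ((2 : ℝ) ^ (-(2 * Δ)) * t ^ (-(2 * Δ))) = m * (2 * t) ^ (-(2 * Δ)) := by rw [hA']
          _ ≤ m * (t + R) ^ (-(2 * Δ)) := mul_le_mul_of_nonneg_left hA hmpos.le
          _ ≤ bump Δ (cfg t) := h1
          _ ≤ ((t - 1) ^ (-(2 * Δ))) ^ 2 := h2
          _ ≤ ((2 : ℝ) ^ (2 * Δ) * t ^ (-(2 * Δ))) ^ 2 := hB2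
          _ = (2 : ℝ) ^ (4 * Δ) * (t ^ (-(2 * Δ)) * t ^ (-(2 * Δ))) := hsq
      have htp : 0 < t ^ (-(2 * Δ)) := Real.rpow_pos_of_pos htpos _
      -- divide by t^{-2Δ}
      have := hchain
      rw [← mul_assoc, ← mul_assoc] at this
      exact le_of_mul_le_mul_right this htp
    -- choose t so large that 2^{4Δ} t^{-2Δ} < m 2^{-2Δ}
    set a : ℝ := (2 : ℝ) ^ (6 * Δ) / m + 1 with ha
    have hapos : 0 < a := by positivity
    set u : ℝ := a ^ (1 / (2 * Δ)) with hu
    have hupos : 0 < u := Real.rpow_pos_of_pos hapos _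
    set t : ℝ := max (2 * (R : ℝ) + 4) (u + 1) with htdef
    have ht1 : 2 * (R : ℝ) + 4 ≤ t := le_max_left _ _
    have ht2 : u < t := lt_of_lt_of_le (by linarith) (le_max_right _ _)
    have htpos : 0 < t := by linarith
    have h2Δ : 0 < 2 * Δ := by linarith
    -- t^{2Δ} > a
    have hta : a < t ^ (2 * Δ) := by
      have h := Real.rpow_lt_rpow hupos.le ht2 h2Δ
      have hua : u ^ (2 * Δ) = a := by
        rw [hu, ← Real.rpow_mul hapos.le, one_div, inv_mul_cancel₀ h2Δ.ne', Real.rpow_one]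
      rwa [hua] at h
    -- hence t^{-2Δ} < m 2^{-6Δ}
    have htneg : t ^ (-(2 * Δ)) < m * (2 : ℝ) ^ (-(6 * Δ)) := by
      rw [Real.rpow_neg htpos.le, Real.rpow_neg (by norm_num : (0:ℝ) ≤ 2)]
      have hq : (2 : ℝ) ^ (6 * Δ) / m < t ^ (2 * Δ) := by linarith
      have h6 : 0 < (2 : ℝ) ^ (6 * Δ) := Real.rpow_pos_of_pos (by norm_num) _
      rw [div_lt_iff₀ hmpos] at hq
      rw [inv_lt_iff_one_lt_mul₀ (Real.rpow_pos_of_pos htpos _)]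
      calc (1 : ℝ) = (2 : ℝ) ^ (6 * Δ) * ((2 : ℝ) ^ (6 * Δ))⁻¹ := by rw [mul_inv_cancel₀ h6.ne']
        _ < t ^ (2 * Δ) * m * ((2 : ℝ) ^ (6 * Δ))⁻¹ := by
            apply mul_lt_mul_of_pos_right hq (inv_pos.2 h6)
        _ = m * ((2 : ℝ) ^ (6 * Δ))⁻¹ * t ^ (2 * Δ) := by ring
    have hk := key t ht1
    -- combine: m 2^{-2Δ} ≤ 2^{4Δ} t^{-2Δ} < 2^{4Δ} m 2^{-6Δ} = m 2^{-2Δ}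
    have h4 : 0 < (2 : ℝ) ^ (4 * Δ) := Real.rpow_pos_of_pos (by norm_num) _
    have hlt : (2 : ℝ) ^ (4 * Δ) * t ^ (-(2 * Δ)) < (2 : ℝ) ^ (4 * Δ) * (m * (2 : ℝ) ^ (-(6 * Δ))) :=
      mul_lt_mul_of_pos_left htneg h4
    have heq : (2 : ℝ) ^ (4 * Δ) * (m * (2 : ℝ) ^ (-(6 * Δ))) = m * (2 : ℝ) ^ (-(2 * Δ)) := by
      have : (2 : ℝ) ^ (4 * Δ) * (2 : ℝ) ^ (-(6 * Δ)) = (2 : ℝ) ^ (-(2 * Δ)) := by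
        rw [← Real.rpow_add (by norm_num : (0:ℝ) < 2)]; ring_nf
      calc (2 : ℝ) ^ (4 * Δ) * (m * (2 : ℝ) ^ (-(6 * Δ))) = m * ((2 : ℝ) ^ (4 * Δ) * (2 : ℝ) ^ (-(6 * Δ))) := by ring
        _ = m * (2 : ℝ) ^ (-(2 * Δ)) := by rw [this]
    linarith

end BarrierEvasionProof

end Summit.CriticalPhenomena.Ising3DConformalLimit.Cruxes.MoebiusLimitOfTwoPointLaw.IdeatorK4R2

end
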